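import Mathlib
import HarnessLib
import Summits.Ventures.LatticeQCDFlow.Scoring.KArmHomogeneityLocalPower

/-!
# THE `k`-ARM HOMOGENEITY THEOREMS WITH ERROR BARS CONSISTENT IN PROBABILITY: CALIBRATION AND
# LOCAL POWER HOLD VERBATIM WHEN `k·V̂ₖ^r → s_r` ONLY IN MEASURE (as batch-means / Γ-method error
# bars do), NOT ALMOST SURELY

HONEST FRAMING: exact (Metropolis-corrected) sampling algorithms for lattice gauge theory;
figures of merit are autocorrelation/cost numbers at stated couplings and volumes; no
continuum-physics claim.

Venture `LatticeQCDFlow` (cell pub-lqcd), topic `Scoring`; FANOUT row 4 (`s0-u1-b`, GEN-34).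
NEW WORK of the cell (classical asymptotics; our formalisation), no definition, nothing cited.

WHY (row 4).  `Scoring/KArmHomogeneityCoverage` / `…LocalPower` assume the scaled squared error
bars converge ALMOST SURELY (`k·V̂ₖ^r → s_r` a.e.), which fits replica bars read along one growing
run but not the cell's batch-means / windowed-autocovariance bars, whose consistency theorems in
the tree (`Scoring/BatchMeans*`, `Scoring/TwoCodeAgreementInProbability`) are IN PROBABILITY.  This
file removes the gap: the general limit theorem is re-proved with `TendstoInMeasure` error bars
(**`kArm_homogeneity_limit_of_tendstoInMeasure`**) — the only two places where almost-sure
convergence entered (Slutsky's error-bar vector, and the eventual agreement of the printed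
statistic with the clamped continuous functional) are replaced by in-measure statements: a vector
of `R` columns converges in measure when its components do (`tendstoInMeasure_euclidean_of_forall`),
and the disagreement event is contained in `⋃_r {k·V̂ₖ^r ≤ m₀}`, whose probability vanishes because
`m₀ < s_r`.  Corollaries: the calibration (**`kArm_homogeneity_coverage_of_tendstoInMeasure`**) and
the local power (**`kArm_homogeneity_localPower_of_tendstoInMeasure`**) with the same limits as before.

NOT CLAIMED: dependent codes; random `R`; rates.
-/

open MeasureTheory ProbabilityTheory Filter Topology Finset
open scoped ENNReal

namespace Summit.Ventures.LatticeQCDFlow.Scoring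

open Set WithLp

/-! ## §1 In-measure bookkeeping -/

section InMeasure

variable {Ω : Type*} [MeasurableSpace Ω] {P : Measure Ω} {R : ℕ}

/-- **A vector converges in measure when its components do** (constant limits, `EuclideanSpace`):
if `X_k^r → c_r` in measure for every `r`, then `toLp (X_k) → toLp c` in measure.  (The zero-limit,
`Fin (W+1)`-indexed form is `Scoring/MeanSubtractedAcovCLT.tendstoInMeasure_euclidean_zero`; this is the
constant-limit, arbitrary-`Fin R` form that Slutsky needs below, with the same `‖v‖ ≤ Σ|v_r|` argument.) [ours] -/
theorem tendstoInMeasure_euclidean_of_forall {X : ℕ → Ω → Fin R → ℝ} {c : Fin R → ℝ}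
    (h : ∀ r, TendstoInMeasure P (fun k ω => X k ω r) atTop (fun _ => c r)) :
    TendstoInMeasure P (fun k ω => (toLp 2 (X k ω) : EuclideanSpace ℝ (Fin R))) atTop
      (fun _ => (toLp 2 c : EuclideanSpace ℝ (Fin R))) := by
  rw [tendstoInMeasure_iff_norm]
  intro ε hε
  rcases Nat.eq_zero_or_pos R with hR | hR
  · -- no coordinates: the norm is `0 < ε`, the bad event is empty
    subst hR
    have hempty : ∀ k : ℕ, {ω : Ω | ε ≤ ‖(toLp 2 (X k ω) : EuclideanSpace ℝ (Fin 0)) - toLp 2 c‖} = ∅ := by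
      intro k
      ext ω
      simp only [Set.mem_setOf_eq, Set.mem_empty_iff_false, iff_false, not_le]
      have : ‖(toLp 2 (X k ω) : EuclideanSpace ℝ (Fin 0)) - toLp 2 c‖ = 0 := by
        rw [EuclideanSpace.norm_eq]; simp
      rw [this]; exact hε
    simp only [hempty, measure_empty]
    exact tendsto_const_nhds
  have hRpos : (0 : ℝ) < R := by exact_mod_cast hR
  haveI : Nonempty (Fin R) := ⟨⟨0, hR⟩⟩
  set δ : ℝ := ε / R with hδ
  have hδpos : 0 < δ := div_pos hε hRpos
  -- the bad event is inside the union of the coordinate bad events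
  have hsub : ∀ k : ℕ, {ω : Ω | ε ≤ ‖(toLp 2 (X k ω) : EuclideanSpace ℝ (Fin R)) - toLp 2 c‖}
      ⊆ ⋃ r : Fin R, {ω : Ω | δ ≤ ‖X k ω r - c r‖} := by
    intro k ω hω
    simp only [Set.mem_setOf_eq] at hω
    simp only [Set.mem_iUnion, Set.mem_setOf_eq]
    by_contra hall
    simp only [not_exists, not_le] at hall
    have hnorm : ‖(toLp 2 (X k ω) : EuclideanSpace ℝ (Fin R)) - toLp 2 c‖ ≤ ∑ r, |X k ω r - c r| := by
      have h1 : (toLp 2 (X k ω) : EuclideanSpace ℝ (Fin R)) - toLp 2 c = toLp 2 (X k ω - c) := rfl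
      rw [h1, EuclideanSpace.norm_eq]
      have h2 : ∑ r, ‖(X k ω - c) r‖ ^ 2 ≤ (∑ r, |X k ω r - c r|) ^ 2 := by
        have h3 : ∑ r, ‖(X k ω - c) r‖ ^ 2 = ∑ r, |X k ω r - c r| ^ 2 := by
          refine Finset.sum_congr rfl fun r _ => ?_
          simp [Real.norm_eq_abs]
        rw [h3]
        exact Finset.sum_sq_le_sq_sum_of_nonneg fun r _ => abs_nonneg _
      calc Real.sqrt (∑ r, ‖(X k ω - c) r‖ ^ 2) ≤ Real.sqrt ((∑ r, |X k ω r - c r|) ^ 2) :=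
            Real.sqrt_le_sqrt h2
        _ = ∑ r, |X k ω r - c r| := Real.sqrt_sq (Finset.sum_nonneg fun r _ => abs_nonneg _)
    have hlt : ∑ r, |X k ω r - c r| < ε := by
      calc ∑ r, |X k ω r - c r| < ∑ _r : Fin R, δ :=
            Finset.sum_lt_sum_of_nonempty Finset.univ_nonempty fun r _ => by
              have := hall r; rwa [Real.norm_eq_abs] at this
        _ = ε := by
          simp only [Finset.sum_const, Finset.card_univ, Fintype.card_fin, nsmul_eq_mul, hδ]
          field_simp
    linarith
  have hcoord : ∀ r : Fin R, Tendsto (fun k : ℕ => P {ω : Ω | δ ≤ ‖X k ω r - c r‖}) atTop (𝓝 0) := by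
    intro r
    have := h r
    rw [tendstoInMeasure_iff_norm] at this
    exact this δ hδpos
  have hsum : Tendsto (fun k : ℕ => ∑ r : Fin R, P {ω : Ω | δ ≤ ‖X k ω r - c r‖}) atTop (𝓝 0) := by
    have := tendsto_finsetSum (Finset.univ : Finset (Fin R)) fun r _ => hcoord r
    simpa using this
  refine tendsto_of_tendsto_of_tendsto_of_le_of_le tendsto_const_nhds hsum
    (fun k => zero_le) fun k => ?_
  exact (measure_mono (hsub k)).trans (measure_iUnion_fintype_le _ _)

/-- If `Y_k → s` in measure with `m₀ < s`, the event `{Y_k ≤ m₀}` has vanishing probability. [ours] -/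
theorem tendsto_measure_le_of_tendstoInMeasure {Y : ℕ → Ω → ℝ} {s m₀ : ℝ} (hm : m₀ < s)
    (h : TendstoInMeasure P Y atTop (fun _ => s)) :
    Tendsto (fun k : ℕ => P {ω : Ω | Y k ω ≤ m₀}) atTop (𝓝 0) := by
  rw [tendstoInMeasure_iff_norm] at h
  have h1 := h (s - m₀) (by linarith)
  refine tendsto_of_tendsto_of_tendsto_of_le_of_le tendsto_const_nhds h1 (fun k => zero_le)
    fun k => measure_mono fun ω hω => ?_
  simp only [Set.mem_setOf_eq] at hω ⊢
  rw [Real.norm_eq_abs]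
  have : s - m₀ ≤ s - Y k ω := by linarith
  exact this.trans (by rw [abs_sub_comm]; exact le_abs_self _)

end InMeasure

/-! ## §2 The general limit theorem with in-measure error bars -/

section Limit

variable {n : ℕ} {Ωs : Fin (n + 2) → Type*} [∀ r, MeasurableSpace (Ωs r)]
  {Ps : (r : Fin (n + 2)) → Measure (Ωs r)} [∀ r, IsProbabilityMeasure (Ps r)]
variable {Ω' : Type*} [MeasurableSpace Ω'] {P' : Measure Ω'} [IsProbabilityMeasure P']

/-- A coordinate event on the product space has the coordinate's probability. -/
theorem pi_measure_setOf_eval (r : Fin (n + 2)) {A : Set (Ωs r)} (hA : MeasurableSet A) :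
    Measure.pi Ps {ω : (i : Fin (n + 2)) → Ωs i | ω r ∈ A} = Ps r A := by
  rw [show {ω : (i : Fin (n + 2)) → Ωs i | ω r ∈ A} = (fun ω : (i : Fin (n + 2)) → Ωs i => ω r) ⁻¹' A
    from rfl, ← Measure.map_apply (measurable_pi_apply r) hA, (measurePreserving_eval Ps r).map_eq]

set_option maxHeartbeats 400000 in
/-- **THE GENERAL LIMIT THEOREM WITH ERROR BARS CONSISTENT IN PROBABILITY.**  As
`kArm_homogeneity_limit`, but code `r`'s scaled squared error bar converges to `s_r > 0` only IN
MEASURE: `k·V̂ₖ^r → s_r` in `P_r`-probability.  Same conclusion: if the limit statistic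
`Σ_r (Z_r − m̂)²/s_r` has no atom at `c`, then `P(Σ_r (Sₖ^r − m̂ₖ)²/V̂ₖ^r ≤ c) → P'(Σ_r (Z_r − m̂)²/s_r ≤ c)`
on `⊗_r P_r`. [ours] -/
theorem kArm_homogeneity_limit_of_tendstoInMeasure {S V : (r : Fin (n + 2)) → ℕ → Ωs r → ℝ} {a : ℝ}
    {s : Fin (n + 2) → ℝ} {Z : Fin (n + 2) → Ω' → ℝ} (hs : ∀ r, 0 < s r)
    (hSm : ∀ r k, Measurable (S r k)) (hVm : ∀ r k, Measurable (V r k))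
    (hclt : ∀ r, TendstoInDistribution (fun (k : ℕ) ω => Real.sqrt k * (S r k ω - a)) atTop (Z r)
      (fun _ => Ps r) P')
    (hZm : ∀ r, Measurable (Z r)) (hind : iIndepFun Z P')
    (hV : ∀ r, TendstoInMeasure (Ps r) (fun (k : ℕ) ω => (k : ℝ) * V r k ω) atTop (fun _ => s r))
    {c : ℝ}
    (hatom : P' {ω' | ∑ r, (Z r ω' - (∑ j, Z j ω' / s j) / (∑ j, (s j)⁻¹)) ^ 2 / s r = c} = 0) :
    Tendsto (fun k : ℕ => (Measure.pi Ps).real {ω : (r : Fin (n + 2)) → Ωs r |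
        ∑ r, (S r k (ω r) - (∑ j, S j k (ω j) / V j k (ω j)) / (∑ j, (V j k (ω j))⁻¹)) ^ 2
          / V r k (ω r) ≤ c})
      atTop (𝓝 (P'.real {ω' | ∑ r, (Z r ω' - (∑ j, Z j ω' / s j) / (∑ j, (s j)⁻¹)) ^ 2 / s r ≤ c})) := by
  -- the clamp
  set m₀ : ℝ := (Finset.univ.inf' Finset.univ_nonempty s) / 2 with hm₀
  have hinf : 0 < Finset.univ.inf' Finset.univ_nonempty s :=
    (Finset.lt_inf'_iff _).2 fun r _ => hs r
  have hm0 : 0 < m₀ := by rw [hm₀]; exact half_pos hinf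
  have hm_le : ∀ r, m₀ < s r := fun r => by
    have : Finset.univ.inf' Finset.univ_nonempty s ≤ s r := Finset.inf'_le _ (Finset.mem_univ r)
    rw [hm₀]; linarith
  -- Step 1: joint convergence of the scaled columns; error-bar vector in measure
  have hXm : ∀ r (k : ℕ), Measurable fun ω : Ωs r => Real.sqrt (k : ℝ) * (S r k ω - a) :=
    fun r k => ((hSm r k).sub_const a).const_mul _
  have hY := CardConsistency.tendstoInDistribution_replicas (Ps := Ps) hclt hXm hZm hind
  have hWm : ∀ k : ℕ, Measurable fun (ω : (r : Fin (n + 2)) → Ωs r) (r : Fin (n + 2)) =>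
      ((k : ℕ) : ℝ) * V r k (ω r) :=
    fun k => measurable_pi_lambda _ fun r => ((hVm r k).comp (measurable_pi_apply r)).const_mul _
  have hWm' : ∀ k : ℕ, Measurable fun (ω : (r : Fin (n + 2)) → Ωs r) =>
      (toLp 2 (fun r : Fin (n + 2) => ((k : ℕ) : ℝ) * V r k (ω r)) : EuclideanSpace ℝ (Fin (n + 2))) :=
    fun k => (WithLp.measurable_toLp 2 _).comp (hWm k)
  -- each scaled error bar, read on the product space, converges in measure
  have hVpi : ∀ r, TendstoInMeasure (Measure.pi Ps)
      (fun (k : ℕ) (ω : (i : Fin (n + 2)) → Ωs i) => (k : ℝ) * V r k (ω r)) atTop (fun _ => s r) := by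
    intro r
    have h1 := hV r
    rw [tendstoInMeasure_iff_norm] at h1 ⊢
    intro ε hε
    have h2 := h1 ε hε
    refine h2.congr fun k => ?_
    have hA : MeasurableSet {x : Ωs r | ε ≤ ‖(k : ℝ) * V r k x - s r‖} :=
      measurableSet_le measurable_const (((hVm r k).const_mul _).sub_const _).norm
    exact (pi_measure_setOf_eval (Ps := Ps) r hA).symm
  have hW : TendstoInMeasure (Measure.pi Ps) (fun (k : ℕ) (ω : (r : Fin (n + 2)) → Ωs r) =>
      (toLp 2 (fun r : Fin (n + 2) => ((k : ℕ) : ℝ) * V r k (ω r)) : EuclideanSpace ℝ (Fin (n + 2))))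
      atTop (fun _ => (toLp 2 s : EuclideanSpace ℝ (Fin (n + 2)))) := by
    have h := tendstoInMeasure_euclidean_of_forall (P := Measure.pi Ps)
      (X := fun (k : ℕ) (ω : (r : Fin (n + 2)) → Ωs r) (r : Fin (n + 2)) => ((k : ℕ) : ℝ) * V r k (ω r))
      (c := s) hVpi
    exact h
  -- Step 2: Slutsky with the clamped functional `F`
  set F : EuclideanSpace ℝ (Fin (n + 2)) × EuclideanSpace ℝ (Fin (n + 2)) → ℝ := fun p =>
    ∑ r, (p.1 r - (∑ j, p.1 j / max (p.2 j) m₀) / (∑ j, (max (p.2 j) m₀)⁻¹)) ^ 2 / max (p.2 r) m₀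
    with hF
  have hgc : Continuous F := continuous_homogeneityClamp (R := n + 2) hm0
  have hsl := hY.continuous_comp_prodMk_of_tendstoInMeasure_const hgc hW (fun k => (hWm' k).aemeasurable)
  have hlim : (fun ω' => F ((toLp 2 fun r => Z r ω' : EuclideanSpace ℝ (Fin (n + 2))),
        (toLp 2 s : EuclideanSpace ℝ (Fin (n + 2)))))
      = fun ω' => ∑ r, (Z r ω' - (∑ j, Z j ω' / s j) / (∑ j, (s j)⁻¹)) ^ 2 / s r := by
    funext ω'
    simp only [hF, max_eq_left (hm_le _).le]
  rw [hlim] at hsl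
  -- Step 3: the printed statistic differs from the clamped functional only on `⋃_r {k V_r ≤ m₀}`
  have hQm : ∀ k : ℕ, Measurable fun ω : (r : Fin (n + 2)) → Ωs r =>
      ∑ r, (S r k (ω r) - (∑ j, S j k (ω j) / V j k (ω j)) / (∑ j, (V j k (ω j))⁻¹)) ^ 2
        / V r k (ω r) := by
    intro k
    have h1 : ∀ r, Measurable fun ω : (r : Fin (n + 2)) → Ωs r => S r k (ω r) :=
      fun r => (hSm r k).comp (measurable_pi_apply r)
    have h2 : ∀ r, Measurable fun ω : (r : Fin (n + 2)) → Ωs r => V r k (ω r) :=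
      fun r => (hVm r k).comp (measurable_pi_apply r)
    fun_prop
  have hagree : ∀ (k : ℕ), 1 ≤ k → ∀ ω : (r : Fin (n + 2)) → Ωs r,
      (∀ r, m₀ < ((k : ℕ) : ℝ) * V r k (ω r)) →
      ∑ r, (S r k (ω r) - (∑ j, S j k (ω j) / V j k (ω j)) / (∑ j, (V j k (ω j))⁻¹)) ^ 2 / V r k (ω r)
        = F ((toLp 2 fun r => Real.sqrt (k : ℝ) * (S r k (ω r) - a) : EuclideanSpace ℝ (Fin (n + 2))),
          (toLp 2 (fun r : Fin (n + 2) => ((k : ℕ) : ℝ) * V r k (ω r)) : EuclideanSpace ℝ (Fin (n + 2)))) := by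
    intro k hk1 ω hk
    have hVpos : ∀ r, 0 < V r k (ω r) := fun r => by
      have := hk r
      have hkpos : (0 : ℝ) < k := by exact_mod_cast hk1
      nlinarith [hm0]
    simp only [hF, max_eq_left (hk _).le]
    rw [homogeneity_statistic_scale hk1 (fun r => S r k (ω r)) (fun r => V r k (ω r)) hVpos a]
  have hdev : TendstoInMeasure (Measure.pi Ps) ((fun (k : ℕ) (ω : (r : Fin (n + 2)) → Ωs r) =>
      ∑ r, (S r k (ω r) - (∑ j, S j k (ω j) / V j k (ω j)) / (∑ j, (V j k (ω j))⁻¹)) ^ 2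
        / V r k (ω r)) - fun (k : ℕ) ω =>
      F ((toLp 2 fun r => Real.sqrt (k : ℝ) * (S r k (ω r) - a) : EuclideanSpace ℝ (Fin (n + 2))),
        (toLp 2 (fun r : Fin (n + 2) => ((k : ℕ) : ℝ) * V r k (ω r)) : EuclideanSpace ℝ (Fin (n + 2)))))
      atTop 0 := by
    rw [tendstoInMeasure_iff_norm]
    intro ε hε
    -- the bad event is inside the union of `{k V_r ≤ m₀}`, eventually in `k`
    have hbad : ∀ r, Tendsto (fun k : ℕ => Measure.pi Ps
        {ω : (i : Fin (n + 2)) → Ωs i | ((k : ℕ) : ℝ) * V r k (ω r) ≤ m₀}) atTop (𝓝 0) :=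
      fun r => tendsto_measure_le_of_tendstoInMeasure (hm_le r) (hVpi r)
    have hsum : Tendsto (fun k : ℕ => ∑ r : Fin (n + 2), Measure.pi Ps
        {ω : (i : Fin (n + 2)) → Ωs i | ((k : ℕ) : ℝ) * V r k (ω r) ≤ m₀}) atTop (𝓝 0) := by
      have := tendsto_finsetSum (Finset.univ : Finset (Fin (n + 2))) fun r _ => hbad r
      simpa using this
    refine tendsto_of_tendsto_of_tendsto_of_le_of_le' tendsto_const_nhds hsum
      (Eventually.of_forall fun k => zero_le) ?_
    filter_upwards [eventually_ge_atTop 1] with k hk1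
    refine (measure_mono fun ω hω => ?_).trans (measure_iUnion_fintype_le _ _)
    simp only [Set.mem_setOf_eq, Pi.sub_apply, Pi.zero_apply, sub_zero] at hω
    simp only [Set.mem_iUnion, Set.mem_setOf_eq]
    by_contra hall
    simp only [not_exists, not_le] at hall
    have heq := hagree k hk1 ω hall
    rw [heq, sub_self, norm_zero] at hω
    exact absurd hω (not_le.2 hε)
  have hQ := tendstoInDistribution_of_tendstoInMeasure_sub _ _ hsl hdev (fun k => (hQm k).aemeasurable)
  -- Step 4: portmanteau
  have hLm : Measurable fun ω' => ∑ r, (Z r ω' - (∑ j, Z j ω' / s j) / (∑ j, (s j)⁻¹)) ^ 2 / s r := by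
    fun_prop
  have hfr : (P'.map fun ω' => ∑ r, (Z r ω' - (∑ j, Z j ω' / s j) / (∑ j, (s j)⁻¹)) ^ 2 / s r)
      (frontier (Iic c)) = 0 := by
    rw [frontier_Iic, Measure.map_apply hLm (measurableSet_singleton c)]
    exact hatom
  exact CardConsistency.tendsto_measureReal_preimage_of_tendstoInDistribution hQ measurableSet_Iic hfr

/-- **CALIBRATION with in-measure error bars**: `Z_r ∼ N(0, s_r)` ⇒ the limit is the nominal
`N(0,1)^{⊗R}{Σ_{r≠0} z_r² ≤ c}`. [ours] -/
theorem kArm_homogeneity_coverage_of_tendstoInMeasure {S V : (r : Fin (n + 2)) → ℕ → Ωs r → ℝ}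
    {a : ℝ} {s : Fin (n + 2) → ℝ} {Z : Fin (n + 2) → Ω' → ℝ} (hs : ∀ r, 0 < s r)
    (hSm : ∀ r k, Measurable (S r k)) (hVm : ∀ r k, Measurable (V r k))
    (hclt : ∀ r, TendstoInDistribution (fun (k : ℕ) ω => Real.sqrt k * (S r k ω - a)) atTop (Z r)
      (fun _ => Ps r) P')
    (hZm : ∀ r, Measurable (Z r)) (hZ : ∀ r, HasLaw (Z r) (gaussianReal 0 (s r).toNNReal) P')
    (hind : iIndepFun Z P')
    (hV : ∀ r, TendstoInMeasure (Ps r) (fun (k : ℕ) ω => (k : ℝ) * V r k ω) atTop (fun _ => s r))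
    (c : ℝ) :
    Tendsto (fun k : ℕ => (Measure.pi Ps).real {ω : (r : Fin (n + 2)) → Ωs r |
        ∑ r, (S r k (ω r) - (∑ j, S j k (ω j) / V j k (ω j)) / (∑ j, (V j k (ω j))⁻¹)) ^ 2
          / V r k (ω r) ≤ c})
      atTop (𝓝 ((Measure.pi fun _ : Fin (n + 2) => gaussianReal 0 1).real
        {z : Fin (n + 2) → ℝ | ∑ r ∈ univ.erase 0, z r ^ 2 ≤ c})) := by
  have hconv := kArm_homogeneity_limit_of_tendstoInMeasure hs hSm hVm hclt hZm hind hV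
    (measure_homogeneity_limit_levelSet_eq_zero hs hZm hZ hind c)
  have hlimit : P'.real {ω' | ∑ r, (Z r ω' - (∑ j, Z j ω' / s j) / (∑ j, (s j)⁻¹)) ^ 2 / s r ≤ c}
      = (Measure.pi fun _ : Fin (n + 2) => gaussianReal 0 1).real
        {z : Fin (n + 2) → ℝ | ∑ r ∈ univ.erase 0, z r ^ 2 ≤ c} := by
    simp only [measureReal_def]
    congr 1
    exact measure_homogeneity_limit_preimage_eq hs hZm hZ hind measurableSet_Iic
  rw [hlimit] at hconv
  exact hconv

/-- **LOCAL POWER with in-measure error bars**: `Z_r ∼ N(h_r, s_r)` ⇒ the limit is the shifted ball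
with `κ² = Σ_r (h_r − h̄_w)²/s_r`. [ours] -/
theorem kArm_homogeneity_localPower_of_tendstoInMeasure {S V : (r : Fin (n + 2)) → ℕ → Ωs r → ℝ}
    {a : ℝ} {h s : Fin (n + 2) → ℝ} {Z : Fin (n + 2) → Ω' → ℝ} (hs : ∀ r, 0 < s r)
    (hSm : ∀ r k, Measurable (S r k)) (hVm : ∀ r k, Measurable (V r k))
    (hclt : ∀ r, TendstoInDistribution (fun (k : ℕ) ω => Real.sqrt k * (S r k ω - a)) atTop (Z r)
      (fun _ => Ps r) P')
    (hZm : ∀ r, Measurable (Z r)) (hZ : ∀ r, HasLaw (Z r) (gaussianReal (h r) (s r).toNNReal) P')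
    (hind : iIndepFun Z P')
    (hV : ∀ r, TendstoInMeasure (Ps r) (fun (k : ℕ) ω => (k : ℝ) * V r k ω) atTop (fun _ => s r))
    (c : ℝ) :
    Tendsto (fun k : ℕ => (Measure.pi Ps).real {ω : (r : Fin (n + 2)) → Ωs r |
        ∑ r, (S r k (ω r) - (∑ j, S j k (ω j) / V j k (ω j)) / (∑ j, (V j k (ω j))⁻¹)) ^ 2
          / V r k (ω r) ≤ c})
      atTop (𝓝 ((Measure.pi fun _ : Fin (n + 2) => gaussianReal 0 1).real
        {z : Fin (n + 2) → ℝ | (z 1 + Real.sqrt (∑ r, (h r - (∑ j, h j / s j) / (∑ j, (s j)⁻¹)) ^ 2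
            / s r)) ^ 2 + ∑ r ∈ (univ.erase 0).erase 1, z r ^ 2 ≤ c})) := by
  have hconv := kArm_homogeneity_limit_of_tendstoInMeasure hs hSm hVm hclt hZm hind hV
    (measure_homogeneity_shifted_levelSet_eq_zero hs hZm hZ hind c)
  have hlimit : P'.real {ω' | ∑ r, (Z r ω' - (∑ j, Z j ω' / s j) / (∑ j, (s j)⁻¹)) ^ 2 / s r ≤ c}
      = (Measure.pi fun _ : Fin (n + 2) => gaussianReal 0 1).real
        {z : Fin (n + 2) → ℝ | (z 1 + Real.sqrt (∑ r, (h r - (∑ j, h j / s j) / (∑ j, (s j)⁻¹)) ^ 2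
            / s r)) ^ 2 + ∑ r ∈ (univ.erase 0).erase 1, z r ^ 2 ≤ c} := by
    simp only [measureReal_def]
    congr 1
    exact measure_homogeneity_shifted_preimage_eq hs hZm hZ hind measurableSet_Iic
  rw [hlimit] at hconv
  exact hconv

end Limit

end Summit.Ventures.LatticeQCDFlow.Scoring
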